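import Mathlib
import Summits.NavierStokesRegularity.NavierStokesRegularity.Theorems.TypeIQuarterGateScarEnvelopeTypeIZoomDictionaryDefs

/-!
# Part A: the abstract zoom dictionary

Part A of the plate (ROUND-29 `Tangent29`): the octave/zoom objects' elementary lemmas (S6), the screen, and S10 — `BudgetAt ν T u a ↔` every abstract tangent flow is regular on the closed unit annulus, given the inputs I0–I3 and the Type-I rate on zooms; plus the discharge of `TypeIOnZooms` from the tree's `IsTypeIBlowup`.

PROVENANCE: declaration texts VERBATIM from the HOME plate `round-31/Tangent31prep.lean` v4 (sha16
`013b26365b5cdf0a`; = ROUND-30 plate v10 + Part K) of the instrument seat nsreg-p3 (g24/g25, cell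
`pub/ns-regularity-ideate`), who cannot write under `Theorems/` (`perm.theorems-prover-only`); landed by the
LEAD-lineage prover ns-sz-p1 g5 on director-ns DIRECTOR-NS #218 (2), split into ≤ 400-line modules (the
plate's `def`s gathered in `TypeIQuarterGateScarEnvelopeTypeIZoomDictionaryDefs`), namespace
`Summit.NavierStokesRegularity.NavierStokesRegularity.Cruxes.ScarEnvelopeTypeI.ZoomDictionary` (the plate's `NsregP3.R30P`), `E3` spelled out, one-line docstrings
added where the plate had none.  `--supports stmt-NavierStokesRegularity-23843 --as helper`.

HONEST FRAMING: dictionary / census TOOLING for the crux `TypeIQuarterGate.ScarEnvelopeTypeI` (item 23843):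
equivalences and normal forms, kernel-checked; NO open statement is proved — 23843, its parent
`QuarterLawTypeI` (23726), the route and Navier–Stokes regularity are OPEN; hard core evaded: none.
-/

-- the summit-side namespace repeats a component by design (single-conjunct summit, D-0017)
set_option linter.dupNamespace false

open MeasureTheory Set Metric Filter Topology
open scoped ENNReal

namespace Summit.NavierStokesRegularity.NavierStokesRegularity.Cruxes.ScarEnvelopeTypeI.ZoomDictionary

variable {u : ℝ → (EuclideanSpace ℝ (Fin 3)) → (EuclideanSpace ℝ (Fin 3))} {a : (EuclideanSpace ℝ (Fin 3))} {ν T : ℝ}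

/-! ## The objects (as in `Scaling29.lean`) -/

/-- `OctaveBudget ν T u` unfolds to `BudgetAt ν T u a` at every singular point `a`. [folklore] -/
theorem octaveBudget_iff_budgetAt :
    Summit.NavierStokesRegularity.NavierStokesRegularity.Cruxes.ScarEnvelopeTypeI.SliceBudget.OctaveBudget
        ν T u ↔
      ∀ a, Summit.NavierStokesRegularity.NavierStokesRegularity.Cruxes.ScarEnvelopeTypeI.SliceBudget.SingularPt
          T u a → BudgetAt ν T u a :=
  Iff.rfl

/-! ## S6 (copied from `Scaling29.lean`, kernel-checked there too) -/

/-- Zoom covariance of octave membership: `y ∈ octAnn 0 r ↔ ℓ•y + a ∈ octAnn a (ℓ r)`. [folklore] -/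
theorem mem_octAnn_zoom {ℓ : ℝ} (hℓ : 0 < ℓ) (r : ℝ) (y : (EuclideanSpace ℝ (Fin 3))) :
    y ∈ octAnn 0 r ↔ ℓ • y + a ∈ octAnn a (ℓ * r) := by
  simp only [octAnn, mem_setOf_eq, sub_zero, add_sub_cancel_right, norm_smul, Real.norm_eq_abs,
    abs_of_pos hℓ]
  constructor
  · rintro ⟨h1, h2⟩
    exact ⟨mul_lt_mul_of_pos_left h1 hℓ, by nlinarith⟩
  · rintro ⟨h1, h2⟩
    refine ⟨lt_of_mul_lt_mul_left h1 hℓ.le, ?_⟩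
    have : ℓ * ‖y‖ < ℓ * (Real.exp 1 * r) := by nlinarith
    exact lt_of_mul_lt_mul_left this hℓ.le

/-- Octave annuli are measurable. [folklore] -/
theorem measurableSet_octAnn (a : (EuclideanSpace ℝ (Fin 3))) (ℓ : ℝ) : MeasurableSet (octAnn a ℓ) := by
  have hc : Continuous fun y : (EuclideanSpace ℝ (Fin 3)) => ‖y - a‖ := by fun_prop
  exact (measurableSet_lt measurable_const hc.measurable).inter
    (measurableSet_lt hc.measurable measurable_const)

/-- Scale covariance of the annular cube: the cube of the zoom at `(r,s)` is the cube of `u` at `(ℓr, T+ℓ²s)`. [folklore] -/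
theorem octaveCube_zoom {ℓ : ℝ} (hℓ : 0 < ℓ) (r s : ℝ) :
    octaveCube (zoom u a T ℓ) 0 r s = octaveCube u a (ℓ * r) (T + ℓ ^ 2 * s) := by
  set t := T + ℓ ^ 2 * s with ht
  let H : (EuclideanSpace ℝ (Fin 3)) → ℝ≥0∞ := (octAnn a (ℓ * r)).indicator fun x => ‖u t x‖ₑ ^ (3 : ℝ)
  have hpt : ∀ y : (EuclideanSpace ℝ (Fin 3)), (octAnn 0 r).indicator (fun y => ‖zoom u a T ℓ s y‖ₑ ^ (3 : ℝ)) y =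
      ENNReal.ofReal ℓ ^ (3 : ℝ) * H (ℓ • y + a) := by
    intro y
    by_cases hy : y ∈ octAnn 0 r
    · have hy' : ℓ • y + a ∈ octAnn a (ℓ * r) := (mem_octAnn_zoom hℓ r y).1 hy
      simp only [H, indicator_of_mem hy, indicator_of_mem hy', zoom, ← ht]
      rw [enorm_smul, Real.enorm_eq_ofReal hℓ.le, add_comm a (ℓ • y),
        ENNReal.mul_rpow_of_nonneg _ _ (by norm_num)]
    · have hy' : ℓ • y + a ∉ octAnn a (ℓ * r) := fun h => hy ((mem_octAnn_zoom hℓ r y).2 h)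
      simp only [H, indicator_of_notMem hy, indicator_of_notMem hy', mul_zero]
  have h3 : ENNReal.ofReal ℓ ^ (3 : ℝ) * ENNReal.ofReal |(ℓ ^ Module.finrank ℝ (EuclideanSpace ℝ (Fin 3)))⁻¹| = 1 := by
    rw [finrank_euclideanSpace_fin, abs_of_pos (inv_pos.2 (pow_pos hℓ 3)),
      ENNReal.ofReal_rpow_of_pos hℓ, Real.rpow_ofNat, ← ENNReal.ofReal_mul (pow_pos hℓ 3).le,
      mul_inv_cancel₀ (pow_pos hℓ 3).ne', ENNReal.ofReal_one]
  calc octaveCube (zoom u a T ℓ) 0 r s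
      = ∫⁻ y, (octAnn 0 r).indicator (fun y => ‖zoom u a T ℓ s y‖ₑ ^ (3 : ℝ)) y := by
        rw [octaveCube, lintegral_indicator (measurableSet_octAnn 0 r)]
    _ = ∫⁻ y, ENNReal.ofReal ℓ ^ (3 : ℝ) * H (ℓ • y + a) := lintegral_congr hpt
    _ = ENNReal.ofReal ℓ ^ (3 : ℝ) * ∫⁻ y, H (ℓ • y + a) := by
        rw [lintegral_const_mul' _ _ (ENNReal.rpow_ne_top_of_nonneg (by norm_num)
          ENNReal.ofReal_ne_top)]
    _ = ENNReal.ofReal ℓ ^ (3 : ℝ) * (ENNReal.ofReal |(ℓ ^ Module.finrank ℝ (EuclideanSpace ℝ (Fin 3)))⁻¹| * ∫⁻ x, H x) := by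
        rw [Literature.Analysis.FluidPDE.PoincareBall.lintegral_comp_smul_add H hℓ.ne' a]
    _ = ∫⁻ x, H x := by rw [← mul_assoc, h3, one_mul]
    _ = octaveCube u a (ℓ * r) t := by
        rw [octaveCube, ← lintegral_indicator (measurableSet_octAnn a (ℓ * r))]

/-- The annular cube of `u` at radius `ℓ` is the UNIT cube of the zoom at scale `ℓ`. [folklore] -/
theorem octaveCube_eq_unitCube_zoom {ℓ : ℝ} (hℓ : 0 < ℓ) (t : ℝ) :
    octaveCube u a ℓ t = octaveCube (zoom u a T ℓ) 0 1 ((t - T) / ℓ ^ 2) := by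
  rw [octaveCube_zoom hℓ, mul_one]
  congr 1
  field_simp
  ring

/-! ## Elementary facts about the screen -/

/-- The closed unit annulus `{1 ≤ ‖y‖ ≤ e}` is compact. [folklore] -/
theorem isCompact_unitAnn : IsCompact unitAnn :=
  (isCompact_closedBall (0 : (EuclideanSpace ℝ (Fin 3))) (Real.exp 1)).of_isClosed_subset
    (isClosed_Icc.preimage continuous_norm) fun y hy => by
      simpa [unitAnn, mem_closedBall, dist_zero_right] using hy.2

/-- The unit octave lies in the closed unit annulus. [folklore] -/
theorem octAnn_subset_unitAnn : octAnn (0 : (EuclideanSpace ℝ (Fin 3))) 1 ⊆ unitAnn := fun y hy => by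
  simp only [octAnn, mem_setOf_eq, sub_zero, mul_one] at hy
  exact ⟨hy.1.le, hy.2.le⟩

/-- The unit octave lies in the ball of radius `e`. [folklore] -/
theorem octAnn_subset_ball : octAnn (0 : (EuclideanSpace ℝ (Fin 3))) 1 ⊆ ball 0 (Real.exp 1) := fun y hy => by
  simp only [octAnn, mem_setOf_eq, sub_zero, mul_one] at hy
  simpa [mem_ball, dist_zero_right] using hy.2

/-- A uniform pointwise bound on the unit octave annulus bounds the unit cube by a finite constant. -/
theorem octaveCube_le_of_bound {v : ℝ → (EuclideanSpace ℝ (Fin 3)) → (EuclideanSpace ℝ (Fin 3))} {s M : ℝ}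
    (h : ∀ z ∈ octAnn (0 : (EuclideanSpace ℝ (Fin 3))) 1, ‖v s z‖ ≤ M) :
    octaveCube v 0 1 s ≤ ENNReal.ofReal M ^ (3 : ℝ) * volume (ball (0 : (EuclideanSpace ℝ (Fin 3))) (Real.exp 1)) := by
  calc octaveCube v 0 1 s ≤ ∫⁻ _ in octAnn (0 : (EuclideanSpace ℝ (Fin 3))) 1, ENNReal.ofReal M ^ (3 : ℝ) := by
        refine setLIntegral_mono measurable_const fun z hz => ?_
        rw [← ofReal_norm]
        exact ENNReal.rpow_le_rpow (ENNReal.ofReal_le_ofReal (h z hz)) (by norm_num)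
    _ = ENNReal.ofReal M ^ (3 : ℝ) * volume (octAnn (0 : (EuclideanSpace ℝ (Fin 3))) 1) := setLIntegral_const _ _
    _ ≤ ENNReal.ofReal M ^ (3 : ℝ) * volume (ball (0 : (EuclideanSpace ℝ (Fin 3))) (Real.exp 1)) := by
        gcongr; exact octAnn_subset_ball

/-- `(M)³ · |B_e| < ⊤` in `ℝ≥0∞` (finiteness of the trivial cube bound). [folklore] -/
theorem bound_lt_top (M : ℝ) :
    ENNReal.ofReal M ^ (3 : ℝ) * volume (ball (0 : (EuclideanSpace ℝ (Fin 3))) (Real.exp 1)) < ⊤ :=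
  ENNReal.mul_lt_top (ENNReal.rpow_lt_top_of_nonneg (by norm_num) ENNReal.ofReal_ne_top)
    measure_ball_lt_top

/-! ## S10 (⇒): budget ⇒ every tangent flow is final-time regular on the annulus -/

/-- S10 (⇒): under I0 and I3, the budget at `a` makes every tangent flow `Reg`-regular on the unit annulus. [folklore] -/
theorem budgetAt_to_regular {Reg : (ℝ → (EuclideanSpace ℝ (Fin 3)) → (EuclideanSpace ℝ (Fin 3))) → (EuclideanSpace ℝ (Fin 3)) → Prop}
    {Tangent : (ℕ → ℝ) → (ℝ → (EuclideanSpace ℝ (Fin 3)) → (EuclideanSpace ℝ (Fin 3))) → Prop} (hν : 0 < ν)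
    (h0 : I0 Tangent) (h3 : I3 u a T Reg Tangent) (hB : BudgetAt ν T u a) :
    ∀ ℓ ū, Tangent ℓ ū → ∀ y ∈ unitAnn, Reg ū y := by
  intro ℓ ū hT
  obtain ⟨hpos, hlim⟩ := h0 ℓ ū hT
  obtain ⟨q, δ, r₀, hδ, hr₀, hb⟩ := hB
  refine h3 ℓ ū hT ⟨q, 1 / (4 * ν), by positivity, ?_⟩
  -- eventually: ℓ_k ≤ r₀ / 2 and ℓ_k ^ 2 / (4 ν) < δ
  have h1 : ∀ᶠ k in atTop, ℓ k ≤ r₀ / 2 := hlim.eventually (Iic_mem_nhds (by positivity))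
  have h2 : ∀ᶠ k in atTop, ℓ k < Real.sqrt (δ * ν) :=
    hlim.eventually (Iio_mem_nhds (Real.sqrt_pos.2 (by positivity)))
  filter_upwards [h1, h2] with k hk1 hk2 s hs r hr
  have hk : 0 < ℓ k := hpos k
  have hsq : ℓ k ^ 2 < δ * ν := by
    have h := Real.sq_sqrt (by positivity : (0:ℝ) ≤ δ * ν)
    nlinarith [hk, Real.sqrt_nonneg (δ * ν)]
  rw [octaveCube_zoom hk]
  apply hb
  · constructor
    · have : ℓ k ^ 2 * (-s) < δ := by
        have hs4 : -s < 1 / (4 * ν) := by linarith [hs.1]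
        have : ℓ k ^ 2 * (-s) ≤ ℓ k ^ 2 * (1 / (4 * ν)) :=
          mul_le_mul_of_nonneg_left hs4.le (sq_nonneg _)
        have h' : ℓ k ^ 2 * (1 / (4 * ν)) < δ * ν * (1 / (4 * ν)) :=
          mul_lt_mul_of_pos_right hsq (by positivity)
        have h'' : δ * ν * (1 / (4 * ν)) = δ / 4 := by field_simp
        linarith
      linarith
    · have : ℓ k ^ 2 * s < 0 := mul_neg_of_pos_of_neg (pow_pos hk 2) hs.2
      linarith
  · rw [Real.sqrt_le_left (mul_nonneg hk.le (by linarith [hr.1]) : 0 ≤ ℓ k * r)]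
    have hr1 : 1 / 2 ≤ r := hr.1
    have hs4 : -s < 1 / (4 * ν) := by linarith [hs.1]
    have : ν * (-s) ≤ 1 / 4 := by
      have := mul_lt_mul_of_pos_left hs4 hν
      have h' : ν * (1 / (4 * ν)) = 1 / 4 := by field_simp
      linarith
    have hl2 : 0 ≤ ℓ k ^ 2 := sq_nonneg _
    nlinarith [mul_le_mul_of_nonneg_left this hl2, mul_le_mul_of_nonneg_left
      (mul_le_mul hr1 hr1 (by norm_num) (by linarith) : (1/2:ℝ) * (1/2) ≤ r * r) hl2]
  · have : r ≤ 2 := hr.2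
    nlinarith

/-! ## S10 (⇐): every tangent flow final-time regular on the annulus ⇒ budget -/

/-- S10 (⇐): under I1, I2 and the Type-I rate on zooms, regularity of all tangent flows on the unit annulus gives the budget at `a`. [folklore] -/
theorem regular_to_budgetAt {Reg : (ℝ → (EuclideanSpace ℝ (Fin 3)) → (EuclideanSpace ℝ (Fin 3))) → (EuclideanSpace ℝ (Fin 3)) → Prop}
    {Tangent : (ℕ → ℝ) → (ℝ → (EuclideanSpace ℝ (Fin 3)) → (EuclideanSpace ℝ (Fin 3))) → Prop} (hν : 0 < ν)
    (h1 : I1 Tangent) (h2 : I2 u a T Reg Tangent) (hTI : TypeIOnZooms ν u a T)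
    (hreg : ∀ ℓ ū, Tangent ℓ ū → ∀ y ∈ unitAnn, Reg ū y) :
    BudgetAt ν T u a := by
  by_contra hB
  -- Step 1: the violating sequence (δ = r₀ = 1/(n+1), q = n).
  have hseq : ∀ n : ℕ, ∃ t ∈ Ioo (T - 1 / ((n:ℝ) + 1)) T, ∃ ℓ : ℝ,
      Real.sqrt (ν * (T - t)) ≤ ℓ ∧ ℓ ≤ 1 / ((n:ℝ) + 1) ∧
        ENNReal.ofReal n < octaveCube u a ℓ t := by
    intro n
    by_contra hn
    push Not at hn
    exact hB ⟨n, 1 / ((n:ℝ) + 1), 1 / ((n:ℝ) + 1), by positivity, by positivity,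
      fun t ht ℓ hl1 hl2 => hn t ht ℓ hl1 hl2⟩
  choose t ht ℓ hadm hsmall hbig using hseq
  have hℓpos : ∀ n, 0 < ℓ n := fun n =>
    lt_of_lt_of_le (Real.sqrt_pos.2 (mul_pos hν (by linarith [(ht n).2]))) (hadm n)
  have hℓlim : Tendsto ℓ atTop (𝓝 0) :=
    squeeze_zero (fun n => (hℓpos n).le) hsmall tendsto_one_div_add_atTop_nhds_zero_nat
  -- rescaled times s_n ∈ [-1/ν, 0)
  set s : ℕ → ℝ := fun n => (t n - T) / ℓ n ^ 2 with hs_def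
  have hs_neg : ∀ n, s n < 0 := fun n =>
    div_neg_of_neg_of_pos (by linarith [(ht n).2]) (pow_pos (hℓpos n) 2)
  have hs_low : ∀ n, -(1 / ν) ≤ s n := by
    intro n
    have hνT : ν * (T - t n) ≤ ℓ n ^ 2 := (Real.sqrt_le_left (hℓpos n).le).1 (hadm n)
    show -(1 / ν) ≤ (t n - T) / ℓ n ^ 2
    rw [le_div_iff₀ (pow_pos (hℓpos n) 2)]
    have h := mul_le_mul_of_nonneg_left hνT (le_of_lt (one_div_pos.2 hν))
    rw [← mul_assoc, one_div_mul_cancel hν.ne', one_mul] at h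
    linarith
  have hcube : ∀ n, octaveCube u a (ℓ n) (t n) = octaveCube (zoom u a T (ℓ n)) 0 1 (s n) :=
    fun n => octaveCube_eq_unitCube_zoom (hℓpos n) (t n)
  -- Step 2: Bolzano–Weierstrass for s, then a tangent flow along a further subsequence.
  obtain ⟨sstar, hsstar, φ, hφ, hsφ⟩ := tendsto_subseq_of_bounded (Metric.isBounded_Icc (-(1/ν)) 0)
    (x := s) fun n => ⟨hs_low n, (hs_neg n).le⟩
  rw [closure_Icc] at hsstar
  obtain ⟨ψ, hψ, ū, hT⟩ := h1 (ℓ ∘ φ) (fun k => hℓpos _) (hℓlim.comp hφ.tendsto_atTop)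
  set L : ℕ → ℝ := ℓ ∘ φ ∘ ψ with hL
  have hLT : Tangent L ū := hT
  have hsL : Tendsto (s ∘ φ ∘ ψ) atTop (𝓝 sstar) := hsφ.comp hψ.tendsto_atTop
  have hLlim : Tendsto L atTop (𝓝 0) := (hℓlim.comp hφ.tendsto_atTop).comp hψ.tendsto_atTop
  have hidx : ∀ k, k ≤ φ (ψ k) := fun k => (hψ.id_le k).trans (hφ.id_le _)
  -- Step 3: an eventual uniform bound M on the unit octave annulus at the times s_{φ ψ k}.
  have hbound : ∃ M : ℝ, ∀ᶠ k in atTop,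
      ∀ z ∈ octAnn (0 : (EuclideanSpace ℝ (Fin 3))) 1, ‖zoom u a T (L k) ((s ∘ φ ∘ ψ) k) z‖ ≤ M := by
    rcases lt_or_eq_of_le hsstar.2 with hlt | heq
    · -- interior final time: the Type-I bound on the zooms
      obtain ⟨C₀, ℓ₀, hℓ₀, hC⟩ := hTI
      refine ⟨C₀ / Real.sqrt (-(sstar / 2)), ?_⟩
      have e1 : ∀ᶠ k in atTop, L k ≤ ℓ₀ := hLlim.eventually (Iic_mem_nhds hℓ₀)
      have e2 : ∀ᶠ k in atTop, (s ∘ φ ∘ ψ) k < sstar / 2 :=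
        hsL.eventually (Iio_mem_nhds (by linarith))
      filter_upwards [e1, e2] with k hk1 hk2 z hz
      have hsk : (s ∘ φ ∘ ψ) k ∈ Ico (-(1 / ν)) 0 := ⟨hs_low _, hs_neg _⟩
      have hb := hC (L k) (hℓpos _) hk1 _ hsk z
      have hC₀ : 0 ≤ C₀ := by
        by_contra hneg
        push Not at hneg
        have : C₀ / Real.sqrt (-(s ∘ φ ∘ ψ) k) < 0 :=
          div_neg_of_neg_of_pos hneg (Real.sqrt_pos.2 (by linarith [hs_neg (φ (ψ k))]))
        linarith [norm_nonneg (zoom u a T (L k) ((s ∘ φ ∘ ψ) k) z)]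
      refine hb.trans (div_le_div_of_nonneg_left hC₀ (Real.sqrt_pos.2 (by linarith)) ?_)
      exact Real.sqrt_le_sqrt (by simp only [Function.comp] at hk2 ⊢; linarith)
    · -- final time 0: regular points of the tangent flow + finite subcover of the annulus
      have hR : ∀ y : unitAnn, ∃ ρ : ℝ, 0 < ρ ∧ ∃ M : ℝ, ∀ᶠ k in atTop,
          ∀ s' ∈ Ioo (-(ρ ^ 2)) 0, ∀ z ∈ ball (y : (EuclideanSpace ℝ (Fin 3))) ρ, ‖zoom u a T (L k) s' z‖ ≤ M :=
        fun y => h2 L ū y y.2 hLT (hreg L ū hLT y y.2)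
      choose ρ hρ M hM using hR
      obtain ⟨tf, htf⟩ := isCompact_unitAnn.elim_finite_subcover (fun y : unitAnn => ball (y : (EuclideanSpace ℝ (Fin 3))) (ρ y))
        (fun _ => isOpen_ball) fun y hy => mem_iUnion.2 ⟨⟨y, hy⟩, mem_ball_self (hρ _)⟩
      refine ⟨∑ i ∈ tf, |M i|, ?_⟩
      have eM : ∀ᶠ k in atTop, ∀ i ∈ tf, ∀ s' ∈ Ioo (-(ρ i ^ 2)) 0, ∀ z ∈ ball (i : (EuclideanSpace ℝ (Fin 3))) (ρ i),
          ‖zoom u a T (L k) s' z‖ ≤ M i := (tf.eventually_all).2 fun i _ => hM i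
      have es : ∀ᶠ k in atTop, ∀ i ∈ tf, -(ρ i ^ 2) < (s ∘ φ ∘ ψ) k :=
        (tf.eventually_all).2 fun i _ =>
          hsL.eventually (Ioi_mem_nhds (by rw [heq]; exact neg_neg_of_pos (pow_pos (hρ i) 2)))
      filter_upwards [eM, es] with k hk1 hk2 z hz
      obtain ⟨i, hi, hzi⟩ : ∃ i ∈ tf, z ∈ ball (i : (EuclideanSpace ℝ (Fin 3))) (ρ i) := by
        simpa only [mem_iUnion, exists_prop] using htf (octAnn_subset_unitAnn hz)
      calc ‖zoom u a T (L k) ((s ∘ φ ∘ ψ) k) z‖ ≤ M i :=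
            hk1 i hi _ ⟨hk2 i hi, hs_neg _⟩ z hzi
        _ ≤ |M i| := le_abs_self _
        _ ≤ ∑ j ∈ tf, |M j| := Finset.single_le_sum (fun j _ => abs_nonneg (M j)) hi
  -- Step 4: contradiction with the cubes exceeding every natural number.
  obtain ⟨M, hM⟩ := hbound
  set B : ℝ≥0∞ := ENNReal.ofReal M ^ (3 : ℝ) * volume (ball (0 : (EuclideanSpace ℝ (Fin 3))) (Real.exp 1)) with hBdef
  have hBtop : B < ⊤ := bound_lt_top M
  obtain ⟨N, hN⟩ := exists_nat_ge B.toReal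
  obtain ⟨k, hk, hkN⟩ := (hM.and (eventually_ge_atTop N)).exists
  have hle : octaveCube (zoom u a T (L k)) 0 1 ((s ∘ φ ∘ ψ) k) ≤ B := octaveCube_le_of_bound hk
  have hgt : ENNReal.ofReal (φ (ψ k) : ℕ) < octaveCube (zoom u a T (L k)) 0 1 ((s ∘ φ ∘ ψ) k) := by
    have := hbig (φ (ψ k))
    rwa [hcube] at this
  have hNB : B ≤ ENNReal.ofReal (φ (ψ k) : ℕ) := by
    rw [← ENNReal.ofReal_toReal hBtop.ne]
    apply ENNReal.ofReal_le_ofReal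
    calc B.toReal ≤ N := hN
      _ ≤ k := by exact_mod_cast hkN
      _ ≤ (φ (ψ k) : ℕ) := by exact_mod_cast hidx k
  exact absurd (hNB.trans_lt hgt) (not_lt.2 hle)

/-- **S10 (the dictionary), both directions.** -/
theorem budgetAt_iff_regular {Reg : (ℝ → (EuclideanSpace ℝ (Fin 3)) → (EuclideanSpace ℝ (Fin 3))) → (EuclideanSpace ℝ (Fin 3)) → Prop}
    {Tangent : (ℕ → ℝ) → (ℝ → (EuclideanSpace ℝ (Fin 3)) → (EuclideanSpace ℝ (Fin 3))) → Prop} (hν : 0 < ν)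
    (h0 : I0 Tangent) (h1 : I1 Tangent) (h2 : I2 u a T Reg Tangent) (h3 : I3 u a T Reg Tangent)
    (hTI : TypeIOnZooms ν u a T) :
    BudgetAt ν T u a ↔ ∀ ℓ ū, Tangent ℓ ū → ∀ y ∈ unitAnn, Reg ū y :=
  ⟨budgetAt_to_regular hν h0 h3, regular_to_budgetAt hν h1 h2 hTI⟩

/-! ## Discharging `TypeIOnZooms` from the tree's `IsTypeIBlowup` (one of S10's four inputs)

`IsTypeIBlowup u T := ∃ C, ∀ᶠ t in 𝓝[<] T, ∀ x, ‖u t x‖ ≤ C / √(T - t)` (tree,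
`Literature.Analysis.FluidPDE.SuitableWeak`).  Zooming by `ℓ ≤ ℓ₀ := √(ν δ)/2`, where `(T-δ, T)`
lies in the eventual set, keeps the zoom's time window `s ∈ [-1/ν, 0)` inside it, and the rate is
scale-invariant: `‖u^{(ℓ)}(s, z)‖ = ℓ ‖u(T+ℓ²s, ·)‖ ≤ ℓ C/√(ℓ²(-s)) = C/√(-s)`. -/

/-- The tree's `IsTypeIBlowup u T` discharges the zoom-level rate hypothesis `TypeIOnZooms`. [folklore] -/
theorem typeIOnZooms_of_isTypeIBlowup (hν : 0 < ν)
    (h : Literature.Analysis.FluidPDE.IsTypeIBlowup u T) (a : (EuclideanSpace ℝ (Fin 3))) : TypeIOnZooms ν u a T := by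
  obtain ⟨C, hC⟩ := h
  obtain ⟨t₀, ht₀, hsub⟩ := mem_nhdsLT_iff_exists_Ioo_subset.1 hC
  have hδ : 0 < T - t₀ := by rw [mem_Iio] at ht₀; linarith
  refine ⟨C, Real.sqrt (ν * (T - t₀)) / 2, by positivity, fun ℓ hℓ hℓ₀ s hs z => ?_⟩
  have hℓ2 : ℓ ^ 2 ≤ ν * (T - t₀) / 4 := by
    have hsq : ℓ ^ 2 ≤ (Real.sqrt (ν * (T - t₀)) / 2) ^ 2 := by gcongr
    rw [div_pow, Real.sq_sqrt (by positivity)] at hsq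
    linarith
  have ht : T + ℓ ^ 2 * s ∈ Ioo t₀ T := by
    constructor
    · have h1 : -(1 / ν) ≤ s := hs.1
      have h3 : ℓ ^ 2 * (-(1 / ν)) ≤ ℓ ^ 2 * s := mul_le_mul_of_nonneg_left h1 (by positivity)
      have h5 : ℓ ^ 2 / ν ≤ (T - t₀) / 4 := by rw [div_le_iff₀ hν]; linarith
      have h4 : ℓ ^ 2 * (-(1 / ν)) = -(ℓ ^ 2 / ν) := by ring
      linarith
    · have : ℓ ^ 2 * s < 0 := mul_neg_of_pos_of_neg (by positivity) hs.2
      linarith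
  have key : ‖u (T + ℓ ^ 2 * s) (a + ℓ • z)‖ ≤ C / Real.sqrt (T - (T + ℓ ^ 2 * s)) := hsub ht _
  have hsp : 0 < Real.sqrt (-s) := Real.sqrt_pos.2 (by linarith [hs.2])
  have hTs : T - (T + ℓ ^ 2 * s) = ℓ ^ 2 * (-s) := by ring
  rw [hTs, Real.sqrt_mul (by positivity) (-s), Real.sqrt_sq hℓ.le] at key
  simp only [zoom, norm_smul, Real.norm_eq_abs, abs_of_pos hℓ]
  calc ℓ * ‖u (T + ℓ ^ 2 * s) (a + ℓ • z)‖ ≤ ℓ * (C / (ℓ * Real.sqrt (-s))) := by gcongr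
    _ = C / Real.sqrt (-s) := by field_simp

/-- S10 with the Type-I input discharged from the tree's `IsTypeIBlowup`. -/
theorem budgetAt_iff_regular' {Reg : (ℝ → (EuclideanSpace ℝ (Fin 3)) → (EuclideanSpace ℝ (Fin 3))) → (EuclideanSpace ℝ (Fin 3)) → Prop}
    {Tangent : (ℕ → ℝ) → (ℝ → (EuclideanSpace ℝ (Fin 3)) → (EuclideanSpace ℝ (Fin 3))) → Prop} (hν : 0 < ν)
    (h0 : I0 Tangent) (h1 : I1 Tangent)
    (h2 : I2 u a T Reg Tangent) (h3 : I3 u a T Reg Tangent)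
    (hTI : Literature.Analysis.FluidPDE.IsTypeIBlowup u T) :
    BudgetAt ν T u a ↔ ∀ ℓ ū, Tangent ℓ ū → ∀ y ∈ unitAnn, Reg ū y :=
  budgetAt_iff_regular hν h0 h1 h2 h3 (typeIOnZooms_of_isTypeIBlowup hν hTI a)

end Summit.NavierStokesRegularity.NavierStokesRegularity.Cruxes.ScarEnvelopeTypeI.ZoomDictionary
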